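import Literature.AnabelianGeometry.AbsoluteAnabelian.AbsTopIII.LogObservablePaths
import HarnessLib

/-!
# [AbsTopIII] Cor. 4.5 (iii), proof: uniqueness of paths of given level; the boundary set `E_log`

Mochizuki, *Topics in Absolute Anabelian Geometry III*, proof of Corollary 4.5 (iii), pp. 109–110
(bib key `MochizukiAbsTopIII2015`; lit key `paper:url-5493eb38cbb7`, kurims manuscript pages).
Continuation of `LogObservablePaths.lean`:
between two first-row vertices of `𝒟_{≤3}` there is at most one path, so a path into `𝒩` from a
given vertex is determined by its level (`obsPath_unique`), and lowering `level p − level q` times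
moves `p` to `q` (`iter_lower_eq`).  Then the boundary set `E_log` of `𝔖_log` in the archimedean
orientation (`ι_× : λ^∼ → λ^×`, Cor. 4.5): co-verticial pairs of paths into `𝒩`, out of a vertex
`≠ 𝒩`, of non-increasing level (`SLogRel`), "satisfies the conditions (a), (b), (c), (d), (e) given
in
§0 for a saturated set" (`isSaturated_sLogRel`).
-/

namespace Literature.AnabelianGeometry.AbsoluteAnabelian.AbsTopIII

open _root_.CategoryTheory _root_.Quiver LogFrobeniusData

universe u

/-! ### Uniqueness of paths of given level -/

/-- The first-row index of a vertex (`none` elsewhere).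
[cite: MochizukiAbsTopIII2015, Corollary 4.5 (iii) p.109] -/
def rowIndex : V3.{u} → Option ℤ
  | .base ⟨.row1 n, _⟩ => some n
  | _ => none

/-- Computation rule. [cite: MochizukiAbsTopIII2015, Corollary 3.6 p.78] -/
theorem rowIndex_lvRow1 (n : ℤ) : rowIndex (lvRow1.{u} n) = some n := rfl

/-- `⋎ ↦` its vertex is injective. [cite: MochizukiAbsTopIII2015, Corollary 3.6 p.78] -/
theorem lvRow1_injective {m n : ℤ} (h : lvRow1.{u} m = lvRow1.{u} n) : m = n := by
  simpa [rowIndex_lvRow1] using congrArg rowIndex h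

/-- Computation rule. [cite: MochizukiAbsTopIII2015, Corollary 3.6 p.78] -/
theorem rowIndex_lvNexus : rowIndex lvNexus.{u} = none := rfl

/-- `□` is not a first-row vertex. [cite: MochizukiAbsTopIII2015, Corollary 3.6 p.78] -/
theorem lvNexus_ne_lvRow1 (n : ℤ) : lvNexus.{u} ≠ lvRow1.{u} n := fun h => by
  simpa [rowIndex_lvRow1, rowIndex_lvNexus] using congrArg rowIndex h

/-- No path leads from `□` back into the first row. [cite: MochizukiAbsTopIII2015, Corollary 3.6
p.78] -/
theorem no_path_nexus_row1 {b : V3.{u}} (p : Path lvNexus.{u} b) : ∀ {n : ℤ}, b ≠ lvRow1.{u} n := by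
  induction p with
  | nil => intro n; exact lvNexus_ne_lvRow1 n
  | cons p e ih =>
    intro n h
    subst h
    obtain rfl := eq_row1_of_hom_row1 e
    exact ih rfl

/-- Every path out of `𝒩` stays at `𝒩`. [cite: MochizukiAbsTopIII2015, Corollary 3.6 p.78] -/
theorem path_from_obs {b : V3.{u}} (p : Path lvObs.{u} b) : b = lvObs.{u} := by
  induction p with
  | nil => rfl
  | cons p e ih => subst ih; exact ((isEmpty_hom_obs' _).false e).elim

/-- The first-row index decreases by the number of `log`s along a path.
[cite: MochizukiAbsTopIII2015, Corollary 4.5 (iii) p.109] -/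
theorem nlogs_row1 {m : ℤ} {b : V3.{u}} (p : Path (lvRow1.{u} m) b) :
    ∀ {n : ℤ}, b = lvRow1.{u} n → m = n + nlogs p := by
  induction p with
  | nil => intro n h; have := lvRow1_injective h; subst this; simp [nlogs]
  | cons p e ih =>
    intro n h
    subst h
    obtain rfl := eq_row1_of_hom_row1 e
    obtain rfl := hom_row1_eq e
    have := ih rfl
    rw [nlogs_cons_log]
    push_cast
    omega

/-- Between two first-row vertices there is at most one path.
[cite: MochizukiAbsTopIII2015, Corollary 4.5 (iii) p.109] -/
theorem row1Path_unique {m : ℤ} {b : V3.{u}} (p : Path (lvRow1.{u} m) b) :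
    ∀ (q : Path (lvRow1.{u} m) b) {n : ℤ}, b = lvRow1.{u} n → p = q := by
  induction p with
  | nil =>
    intro q n _
    cases q with
    | nil => rfl
    | cons q' e' =>
      exfalso
      obtain rfl := eq_row1_of_hom_row1 e'
      have := nlogs_row1 q' rfl
      omega
  | cons p' e ih =>
    intro q n hc
    cases q with
    | nil =>
      exfalso
      obtain rfl := eq_row1_of_hom_row1 e
      have := nlogs_row1 p' rfl
      omega
    | cons q' e' =>
      subst hc
      obtain rfl := eq_row1_of_hom_row1 e
      obtain rfl := eq_row1_of_hom_row1 e'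
      obtain rfl := hom_row1_eq e
      obtain rfl := hom_row1_eq e'
      rw [ih q' rfl]

/-- Into `□` there is at most one path with a given number of `log`s.
[cite: MochizukiAbsTopIII2015, Corollary 4.5 (iii) p.109] -/
theorem nexusPath_unique {a : V3.{u}} (p q : Path a lvNexus.{u}) (h : nlogs p = nlogs q) : p = q := by
  cases p with
  | nil =>
    cases q with
    | nil => rfl
    | cons q₁ e₁ =>
      obtain ⟨n, rfl⟩ := eq_row1_of_hom_nexus e₁
      exact absurd rfl (no_path_nexus_row1 q₁)
  | cons p₁ e₁ =>
    obtain ⟨n, rfl⟩ := eq_row1_of_hom_nexus e₁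
    cases q with
    | nil => exact absurd rfl (no_path_nexus_row1 p₁)
    | cons q₁ e₁' =>
      obtain ⟨n', rfl⟩ := eq_row1_of_hom_nexus e₁'
      obtain rfl : e₁ = idE n := rfl
      obtain rfl : e₁' = idE n' := rfl
      rw [nlogs_cons_id, nlogs_cons_id] at h
      rcases V3.cases a with ⟨m, rfl⟩ | rfl | rfl
      · have h1 := nlogs_row1 p₁ rfl
        have h2 := nlogs_row1 q₁ rfl
        have hn : n = n' := by omega
        subst hn
        rw [row1Path_unique p₁ q₁ rfl]
      · exact absurd rfl (no_path_nexus_row1 p₁)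
      · exact absurd (path_from_obs p₁) (by simp [lvRow1, lvObs, ExtShape.base, ExtShape.obs])

/-- **Uniqueness**: two paths into `𝒩` from the same vertex with the same level are equal.
[cite: MochizukiAbsTopIII2015, Corollary 4.5 (iii) p.109] -/
theorem obsPath_unique {a : V3.{u}} (p q : Path a lvObs.{u}) (ha : a ≠ lvObs.{u})
    (h : level p = level q) : p = q := by
  cases p with
  | nil => exact absurd rfl ha
  | cons p₀ e =>
    obtain rfl := eq_nexus_of_hom_obs e
    cases q with
    | nil => exact absurd rfl ha
    | cons q₀ e' =>
      obtain rfl := eq_nexus_of_hom_obs e'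
      rcases hom_obs_eq e with rfl | rfl <;> rcases hom_obs_eq e' with rfl | rfl <;>
        simp only [level_cons_lamTimes, level_cons_lamPf] at h
      · rw [nexusPath_unique p₀ q₀ (by omega)]
      · omega
      · omega
      · rw [nexusPath_unique p₀ q₀ (by omega)]

/-- Lowering `level p − level q` times moves `p` to the unique path `q` of lower level.
[cite: MochizukiAbsTopIII2015, Corollary 4.5 (iii) p.109] -/
theorem iter_lower_eq {a : V3.{u}} (ha : a ≠ lvObs.{u}) :
    ∀ (d : ℕ) (p q : Path a lvObs.{u}), level p = level q + d → lower^[d] p = q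
  | 0, p, q, h => obsPath_unique p q ha (by omega)
  | d + 1, p, q, h => by
    have h1 : level (lower p) = level q + d := by rw [level_lower p ha]; omega
    exact iter_lower_eq ha d (lower p) q h1

/-- `iter_lower_eq` with the target presented as a variable. [cite: MochizukiAbsTopIII2015,
Corollary 4.5 (iii) p.109] -/
theorem iter_lower_eq' {a b : V3.{u}} (hb : b = lvObs.{u}) (ha : a ≠ lvObs.{u}) (d : ℕ)
    (p q : Path a b) (h : level p = level q + d) : lower^[d] p = q := by
  subst hb; exact iter_lower_eq ha d p q h

/-- The only loop at `𝒩` is the empty path. [cite: MochizukiAbsTopIII2015, Corollary 3.6 p.78] -/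
theorem path_obs_obs_eq_nil (r : Path lvObs.{u} lvObs.{u}) : r = Path.nil := by
  cases r with
  | nil => rfl
  | cons r e => obtain rfl := path_from_obs r; exact ((isEmpty_hom_obs' _).false e).elim

/-- Pre-composition shifts the level by `2·nlogs`. [cite: MochizukiAbsTopIII2015, Corollary 4.5
(iii) p.109] -/
theorem level_comp {c a : V3.{u}} (r : Path c a) (p : Path a lvObs.{u}) (ha : a ≠ lvObs.{u}) :
    level (r.comp p) = 2 * nlogs r + level p := by
  cases p with
  | nil => exact absurd rfl ha
  | cons p₀ e =>
    simp only [Path.comp_cons, level, nlogs, lastTimes, nlogs_comp, Nat.mul_add, Nat.add_assoc]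
    rfl

/-- A first-row vertex is not `𝒩`. [cite: MochizukiAbsTopIII2015, Corollary 3.6 p.78] -/
theorem lvRow1_ne_lvObs (n : ℤ) : lvRow1.{u} n ≠ lvObs.{u} := by
  simp [lvRow1, lvObs, ExtShape.base, ExtShape.obs]

/-- `□` is not `𝒩`. [cite: MochizukiAbsTopIII2015, Corollary 3.6 p.78] -/
theorem lvNexus_ne_lvObs : lvNexus.{u} ≠ lvObs.{u} := by
  simp [lvNexus, lvObs, ExtShape.base, ExtShape.obs]

/-! ### The strict family of homotopies `𝔖_log` (archimedean orientation) -/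

/-- The boundary set of `𝔖_log`: co-verticial pairs of paths into `𝒩`, out of a vertex other than
`𝒩`, whose second member has level at most that of the first (the saturation of the printed types
(1)–(4); type (5) = the reflexive pairs).
[cite: MochizukiAbsTopIII2015, Corollary 4.5 (iii) p.109] -/
def SLogRel : ∀ ⦃a b : V3.{u}⦄, Path a b → Path a b → Prop :=
  fun a b p q => b = lvObs.{u} ∧ a ≠ lvObs.{u} ∧ level q ≤ level p

/-- "`E_log` satisfies the conditions (a), (b), (c), (d), (e) given in §0 for a saturated set."
[cite: MochizukiAbsTopIII2015, Corollary 4.5 (iii) p.109] -/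
theorem isSaturated_sLogRel : IsSaturated SLogRel.{u} where
  refl_left := fun _ _ _ _ h => ⟨h.1, h.2.1, le_rfl⟩
  refl_right := fun _ _ _ _ h => ⟨h.1, h.2.1, le_rfl⟩
  trans := fun _ _ _ _ _ h₁ h₂ => ⟨h₁.1, h₁.2.1, h₂.2.2.trans h₁.2.2⟩
  precomp := by
    rintro a b c p q ⟨rfl, ha, hle⟩ r
    have hc : c ≠ lvObs := by rintro rfl; exact ha (path_from_obs r)
    exact ⟨rfl, hc, by rw [level_comp r p ha, level_comp r q ha]; omega⟩
  postcomp := by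
    rintro a b c p q ⟨rfl, ha, hle⟩ r
    obtain rfl := path_from_obs r
    obtain rfl := path_obs_obs_eq_nil r
    exact ⟨rfl, ha, hle⟩

end Literature.AnabelianGeometry.AbsoluteAnabelian.AbsTopIII
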